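import Summits.BirchSwinnertonDyer.BirchSwinnertonDyer.Theorems.Rank2Observatory2DescKillSig2XWalk
import HarnessLib

/-!
# KERNEL-2DESC — the 2-ADIC signature certificate for ONE `ℤ₂`-root + a QUADRATIC place (`KillSig2X`), PART 4 of 5:
# the index lemma, the root relations in certificate coordinates, and the DRIVER
# (rank-2 observatory, cert-1 gen 40; design `b2b-bsdr2-cert-1/…/generics/sig2x/README-SIG2X.md`, census `census/sig2x/`)

HONEST FRAMING: per-curve certified theorems and census instruments; no claim on BSD in rank ≥ 2.
PARTITION: none — rank ≥ 2 data (N3); no r ≤ 1 cell claimed.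

* `index12` — `[ℤ₂ × O_w : ℤ₂[θ]] ∣ 2^D` (`det V = q·N(ε − A) = 2^D·f`, `f` odd, `V` the value matrix of `1, θ, θ²`
  at the root `ε` and at `A = p + q·w`): values divisible by `2^(D+1)` at both places force `2 ∣ r₀, r₁, r₂`;
* `lin_rel2x`, `quad_rel2x` — the linear (`KillSig3Core.root_rel`) and quadratic (PART 1 `root_rel₂`) root
  relations of a kill solution, in the certificate's coordinates (`rootData`, `psplit ∘ pmod ∘ pev`);
* `driver2x` — THE DRIVER, shared by the unramified and the ramified checker (PART 5): from the two relations for a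
  primitive solution `(r, n)` it derives `False`, given (i) the index hypothesis, (ii) the quadratic valuation anchor
  (`sqU` / `sqE`), (iii) a certified walk refuting every unit `y ≡ z·ρ²/n²` (`walk2x_sound` with the two leaf
  tests), (iv) the quadratic core lemma in pattern form and (v) the exclusion of the 16 RATIONAL-like patterns.
  The case analysis is on `n`: `n` odd (walk, `K = 0`, `y = w₀·m²`, `m ≡ n⁻¹`); `n = 2^τ n'`, `n'` odd, and
  `2^{2τ} ∣ w₀` (walk with the even offset `K = 2τ ≤ B` — the ANCHOR: `2^(B+1) ∣ w₀, n²` would make the values at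
  both places divisible by `2^(D+1)`, contradicting primitivity via `index12`); otherwise (`w₀ = 2^μ P`, `μ < 2τ` or
  `n = 0`) the point is RATIONAL-like: `core8` pins `(s + μ) mod 2` and `u mod 8`, the quadratic core lemma pins the
  quadratic class, and the certificate excluded that pattern (`g = 2τ − μ ≥ 1` enters only through `g mod 2` and
  `2^g mod 8`, whence the 16 patterns `g ∈ {1,2,3,4}`, `P mod 8 ∈ {1,3,5,7}`).

Integer (pair) arithmetic only; no instances, no `native_decide`, sorry-free.
[cite: Cassels1991LecturesEllipticCurves, §15] [cite: CremonaAlgorithms1997, §3.6]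
-/

-- single-conjunct summit: `Summit.BirchSwinnertonDyer.BirchSwinnertonDyer.…` repeats the name by design
set_option linter.dupNamespace false

namespace Summit.BirchSwinnertonDyer.BirchSwinnertonDyer.Rank2Observatory.TwoDescKill

/-! ### The index lemma for `ℤ₂ × O_w ⊇ ℤ₂[θ]` -/

/-- **INDEX LEMMA at a split `(1, 2)` prime.** With `V = [[1, ε, ε²], [1, p, (A²)₀], [0, q, (A²)₁]]` (the values of
`1, θ, θ²` at the root `ε` and at `A = p + q·w`), `det V = q·((ε − p)² − s₁q(ε − p) − s₀q²) = 2^D·f` with `f` odd,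
and `adj V · V = det V · I`: if `2^(D+1)` divides `r₀ + r₁ε + r₂ε²` and both coordinates of `r(A)`, then
`2 ∣ r₀, r₁, r₂`. [cite: CremonaAlgorithms1997, §3.6] -/
theorem index12 {s₁ s₀ ε p q r₀ r₁ r₂ f : ℤ} {D : ℕ}
    (hΔ : q * ((ε - p) ^ 2 - s₁ * q * (ε - p) - s₀ * q ^ 2) = (2 : ℤ) ^ D * f) (hf : ¬ (2 : ℤ) ∣ f)
    (hRε : (2 : ℤ) ^ (D + 1) ∣ r₀ + r₁ * ε + r₂ * ε ^ 2)
    (hR₁ : (2 : ℤ) ^ (D + 1) ∣ (pev s₁ s₀ (p, q) (r₀, r₁, r₂)).1)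
    (hR₂ : (2 : ℤ) ^ (D + 1) ∣ (pev s₁ s₀ (p, q) (r₀, r₁, r₂)).2) :
    (2 : ℤ) ∣ r₀ ∧ (2 : ℤ) ∣ r₁ ∧ (2 : ℤ) ∣ r₂ := by
  have hpZ : Prime (2 : ℤ) := Int.prime_two
  obtain ⟨k₁, hk₁⟩ := hRε
  obtain ⟨k₂, hk₂⟩ := hR₁
  obtain ⟨k₃, hk₃⟩ := hR₂
  simp only [pev, padd, psc, qmul] at hk₂ hk₃
  have aux : ∀ x k : ℤ, q * ((ε - p) ^ 2 - s₁ * q * (ε - p) - s₀ * q ^ 2) * x = (2 : ℤ) ^ (D + 1) * k →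
      (2 : ℤ) ∣ x := by
    intro x k hx
    rw [hΔ, pow_succ] at hx
    have h1 : (2 : ℤ) ^ D * (f * x) = (2 : ℤ) ^ D * (2 * k) := by linear_combination hx
    have h2 := mul_left_cancel₀ (pow_ne_zero D (by norm_num : (2 : ℤ) ≠ 0)) h1
    rcases hpZ.dvd_or_dvd (⟨k, by linear_combination h2⟩ : (2 : ℤ) ∣ f * x) with h | h
    · exact absurd h hf
    · exact h
  refine ⟨aux r₀ (k₁ * (p * (p * q + q * p + q * q * s₁) - q * (p * p + q * q * s₀)) +
      k₂ * (-(ε * (p * q + q * p + q * q * s₁) - ε ^ 2 * q)) + k₃ * (ε * (p * p + q * q * s₀) - ε ^ 2 * p)) ?_,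
    aux r₁ (k₁ * (-(p * q + q * p + q * q * s₁)) + k₂ * (p * q + q * p + q * q * s₁) +
      k₃ * (ε ^ 2 - (p * p + q * q * s₀))) ?_,
    aux r₂ (k₁ * q + k₂ * (-q) + k₃ * (p - ε)) ?_⟩
  · linear_combination (p * (p * q + q * p + q * q * s₁) - q * (p * p + q * q * s₀)) * hk₁ +
      (-(ε * (p * q + q * p + q * q * s₁) - ε ^ 2 * q)) * hk₂ + (ε * (p * p + q * q * s₀) - ε ^ 2 * p) * hk₃
  · linear_combination (-(p * q + q * p + q * q * s₁)) * hk₁ + (p * q + q * p + q * q * s₁) * hk₂ +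
      (ε ^ 2 - (p * p + q * q * s₀)) * hk₃
  · linear_combination q * hk₁ + (-q) * hk₂ + (p - ε) * hk₃

/-! ### The two root relations in certificate coordinates -/

/-- `x mod 2^N` coordinate-wise. [folklore] -/
def pmod (N : ℕ) (x : ℤ × ℤ) : ℤ × ℤ := (x.1 % (2 : ℤ) ^ N, x.2 % (2 : ℤ) ^ N)

/-- The LINEAR root relation of `KillSig3Core.root_rel` in `rootData` form (as in `sig8Check_sound`):
`2^N ∣ 2^{s}·u·(r₀ + r₁ε + r₂ε²)² − (w₀ − n²·e)` with `rootData 2 N z t₁ t₂ ε = (e, s, u)`. [folklore] -/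
theorem lin_rel2x {N : ℕ} {a b c : ℤ} {z : ℤ × ℤ × ℤ} {t₁ t₂ ε r₀ r₁ r₂ n : ℤ}
    (hg : (ε ^ 3 + a * ε ^ 2 + b * ε + c) % ((2 ^ N : ℕ) : ℤ) = 0)
    (h0 : killQ a b c z t₁ t₂ (r₀, r₁, r₂, n) = 0) :
    (2 : ℤ) ^ N ∣ (2 : ℤ) ^ (rootData 2 N z t₁ t₂ ε).2.1 * (rootData 2 N z t₁ t₂ ε).2.2 *
        (r₀ + r₁ * ε + r₂ * ε ^ 2) ^ 2 - ((zsq a b c z (r₀, r₁, r₂)).1 - n ^ 2 * (rootData 2 N z t₁ t₂ ε).1) := by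
  have h1 := root_rel hg h0
  have h2 := splitPow_spec 2 N ((z.1 + z.2.1 * ε + z.2.2 * ε ^ 2) % ((2 ^ N : ℕ) : ℤ))
  simp only [Nat.cast_ofNat] at h1 h2
  simp only [rootData]
  rw [← h2]
  exact h1

/-- The QUADRATIC root relation of PART 1 (`root_rel₂`) in certificate coordinates: with
`psplit N (pmod N (z(A))) = (s, Z')`, `pmod N (T(A)) = Ê` (`T = (0, t₁, t₂)`), `g(A) ≡ 0 (mod 2^N)` and
`R = r(A)`, a kill solution gives `2^N ∣ 2^s·(Z'·R²) − (w₀ − n²Ê₀, −n²Ê₁)` coordinate-wise. [folklore] -/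
theorem quad_rel2x {N : ℕ} {s₁ s₀ a b c : ℤ} {A : ℤ × ℤ} {z : ℤ × ℤ × ℤ} {t₁ t₂ r₀ r₁ r₂ n : ℤ} {s : ℕ}
    {Z' E : ℤ × ℤ} (hG₁ : (pg s₁ s₀ a b c A).1 % (2 : ℤ) ^ N = 0) (hG₂ : (pg s₁ s₀ a b c A).2 % (2 : ℤ) ^ N = 0)
    (hζ : psplit N (pmod N (pev s₁ s₀ A z)) = (s, Z')) (hE : pmod N (pev s₁ s₀ A (0, t₁, t₂)) = E)
    (h0 : killQ a b c z t₁ t₂ (r₀, r₁, r₂, n) = 0) :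
    (2 : ℤ) ^ N ∣ (2 : ℤ) ^ s *
        (qmul s₁ s₀ Z' (qmul s₁ s₀ (pev s₁ s₀ A (r₀, r₁, r₂)) (pev s₁ s₀ A (r₀, r₁, r₂)))).1 -
        ((zsq a b c z (r₀, r₁, r₂)).1 - n ^ 2 * E.1) ∧
      (2 : ℤ) ^ N ∣ (2 : ℤ) ^ s *
        (qmul s₁ s₀ Z' (qmul s₁ s₀ (pev s₁ s₀ A (r₀, r₁, r₂)) (pev s₁ s₀ A (r₀, r₁, r₂)))).2 -
        (-(n ^ 2 * E.2)) := by
  obtain ⟨h₁, h₂⟩ := root_rel₂ (s₁ := s₁) (s₀ := s₀) (m := (2 : ℤ) ^ N) (Int.dvd_of_emod_eq_zero hG₁)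
    (Int.dvd_of_emod_eq_zero hG₂) h0
  subst hE
  obtain ⟨sp₁, sp₂⟩ := psplit_spec N (pmod N (pev s₁ s₀ A z))
  rw [hζ] at sp₁ sp₂
  simp only [pmod] at sp₁ sp₂ ⊢
  set X := qmul s₁ s₀ (pev s₁ s₀ A (r₀, r₁, r₂)) (pev s₁ s₀ A (r₀, r₁, r₂)) with hX
  -- `Z ≡ 2^s • Z'` and `T(A) ≡ Ê (mod 2^N)`
  have cZ₁ : (pev s₁ s₀ A z).1 ≡ (2 : ℤ) ^ s * Z'.1 [ZMOD (2 : ℤ) ^ N] := by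
    rw [← sp₁]; exact (Int.mod_modEq _ _).symm
  have cZ₂ : (pev s₁ s₀ A z).2 ≡ (2 : ℤ) ^ s * Z'.2 [ZMOD (2 : ℤ) ^ N] := by
    rw [← sp₂]; exact (Int.mod_modEq _ _).symm
  have cE₁ : n ^ 2 * (pev s₁ s₀ A (0, t₁, t₂)).1 ≡ n ^ 2 * ((pev s₁ s₀ A (0, t₁, t₂)).1 % (2 : ℤ) ^ N)
      [ZMOD (2 : ℤ) ^ N] := (Int.mod_modEq _ _).symm.mul_left _
  have cE₂ : n ^ 2 * (pev s₁ s₀ A (0, t₁, t₂)).2 ≡ n ^ 2 * ((pev s₁ s₀ A (0, t₁, t₂)).2 % (2 : ℤ) ^ N)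
      [ZMOD (2 : ℤ) ^ N] := (Int.mod_modEq _ _).symm.mul_left _
  obtain ⟨m₁, m₂⟩ := qmul_modEq (x' := ((2 : ℤ) ^ s * Z'.1, (2 : ℤ) ^ s * Z'.2)) (y := X) (y' := X) cZ₁ cZ₂
    (Int.ModEq.refl _) (Int.ModEq.refl _)
  have e₁ : (qmul s₁ s₀ ((2 : ℤ) ^ s * Z'.1, (2 : ℤ) ^ s * Z'.2) X).1 = (2 : ℤ) ^ s * (qmul s₁ s₀ Z' X).1 := by
    simp only [qmul]; ring
  have e₂ : (qmul s₁ s₀ ((2 : ℤ) ^ s * Z'.1, (2 : ℤ) ^ s * Z'.2) X).2 = (2 : ℤ) ^ s * (qmul s₁ s₀ Z' X).2 := by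
    simp only [qmul]; ring
  rw [e₁] at m₁
  rw [e₂] at m₂
  constructor
  · apply Int.modEq_iff_dvd.mp
    calc (zsq a b c z (r₀, r₁, r₂)).1 - n ^ 2 * ((pev s₁ s₀ A (0, t₁, t₂)).1 % (2 : ℤ) ^ N)
        ≡ (zsq a b c z (r₀, r₁, r₂)).1 - n ^ 2 * (pev s₁ s₀ A (0, t₁, t₂)).1 [ZMOD (2 : ℤ) ^ N] :=
          (Int.ModEq.refl _).sub cE₁.symm
      _ ≡ (qmul s₁ s₀ (pev s₁ s₀ A z) X).1 [ZMOD (2 : ℤ) ^ N] := Int.modEq_iff_dvd.mpr h₁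
      _ ≡ (2 : ℤ) ^ s * (qmul s₁ s₀ Z' X).1 [ZMOD (2 : ℤ) ^ N] := m₁
  · apply Int.modEq_iff_dvd.mp
    calc -(n ^ 2 * ((pev s₁ s₀ A (0, t₁, t₂)).2 % (2 : ℤ) ^ N))
        ≡ 0 - n ^ 2 * (pev s₁ s₀ A (0, t₁, t₂)).2 [ZMOD (2 : ℤ) ^ N] := by
          rw [← zero_sub]; exact (Int.ModEq.refl _).sub cE₂.symm
      _ ≡ (qmul s₁ s₀ (pev s₁ s₀ A z) X).2 [ZMOD (2 : ℤ) ^ N] := Int.modEq_iff_dvd.mpr h₂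
      _ ≡ (2 : ℤ) ^ s * (qmul s₁ s₀ Z' X).2 [ZMOD (2 : ℤ) ^ N] := m₂

/-! ### The driver -/

/-- `2^(B+1) ∤ w` ⟹ `w = 2^μ·P` with `P` odd and `μ ≤ B`. [folklore] -/
theorem split_of_not_dvd {B : ℕ} {w : ℤ} (hw : ¬ (2 : ℤ) ^ (B + 1) ∣ w) :
    ∃ (μ : ℕ) (P : ℤ), w = (2 : ℤ) ^ μ * P ∧ ¬ (2 : ℤ) ∣ P ∧ μ ≤ B := by
  have hw0 : w ≠ 0 := fun h => hw (h ▸ dvd_zero _)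
  obtain ⟨μ, P, hP, hPodd⟩ : ∃ (k : ℕ) (x' : ℤ), w = (2 : ℤ) ^ k * x' ∧ ¬ (2 : ℤ) ∣ x' :=
    ⟨_, (Int.finiteMultiplicity_iff.mpr ⟨by decide, hw0⟩).exists_eq_pow_mul_and_not_dvd⟩
  refine ⟨μ, P, hP, hPodd, ?_⟩
  by_contra hlt
  exact hw (hP ▸ dvd_mul_of_dvd_left (pow_dvd_pow _ (by omega)) P)

/-- Reduction of a RATIONAL-like pattern `(g, P)` (`g ≥ 1`, `P` odd) to the 16 tested ones: some `g' ∈ {1,2,3,4}`,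
`P₈ ∈ {1,3,5,7}` with `g' ≡ g (mod 2)`, `2^{g'} ≡ 2^g (mod 8)`, `P₈ ≡ P (mod 8)`. [folklore] -/
theorem reduce_gP {g : ℕ} (hg : 1 ≤ g) {P : ℤ} (hP : ¬ (2 : ℤ) ∣ P) :
    ∃ g' ∈ ([1, 2, 3, 4] : List ℕ), ∃ P8 ∈ ([1, 3, 5, 7] : List ℤ),
      g' % 2 = g % 2 ∧ (2 : ℤ) ^ g' ≡ (2 : ℤ) ^ g [ZMOD 8] ∧ P8 ≡ P [ZMOD 8] := by
  have hP8 : P % 8 ∈ ([1, 3, 5, 7] : List ℤ) := by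
    have h2 : P % 2 = 1 := Int.two_dvd_ne_zero.mp hP
    have h : P % 8 = 1 ∨ P % 8 = 3 ∨ P % 8 = 5 ∨ P % 8 = 7 := by omega
    rcases h with h | h | h | h <;> simp [h]
  have hPm : P % 8 ≡ P [ZMOD 8] := Int.mod_modEq P 8
  by_cases hg4 : g ≤ 4
  · refine ⟨g, ?_, P % 8, hP8, rfl, Int.ModEq.refl _, hPm⟩
    interval_cases g <;> simp
  · have z8 : ∀ h : ℕ, 3 ≤ h → (2 : ℤ) ^ h ≡ 0 [ZMOD 8] := by
      intro h hh
      obtain ⟨k, rfl⟩ : ∃ k, h = 3 + k := ⟨h - 3, by omega⟩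
      exact Int.modEq_zero_iff_dvd.mpr (by rw [pow_add]; exact dvd_mul_of_dvd_left (by norm_num) _)
    rcases Nat.mod_two_eq_zero_or_one g with hpar | hpar
    · exact ⟨4, by simp, P % 8, hP8, by omega, (z8 4 (by omega)).trans (z8 g (by omega)).symm, hPm⟩
    · exact ⟨3, by simp, P % 8, hP8, by omega, (z8 3 le_rfl).trans (z8 g (by omega)).symm, hPm⟩

/-- **THE DRIVER.** From the linear relation at the root (`rootData` triple `ρ = (e, s, u)`, `u` odd) and the
(shape-normalised) quadratic relation (`2^N ∣ 2^{sq}·Zq·R² − w^b·(w₀ − n²Ê₀, −n²Ê₁)`) of a solution with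
`2 ∣ n ⟹ ¬(2^(D+1) ∣ Rε, R₀, R₁)` (index + primitivity), the quadratic anchor `hquad`, a certified walk `hwalkS`,
the quadratic core lemma in pattern form `hcoreQ` and the pattern exclusion `hexcl`: `False`.  See the module
docstring for the case analysis. [cite: CremonaAlgorithms1997, §3.6] -/
theorem driver2x {s₁ s₀ cw dw : ℤ} {b : Bool} {N B D sq : ℕ} {ρ : ℤ × ℕ × ℤ} {Zq E R : ℤ × ℤ}
    {qpat : ℕ → ℤ → Bool} {w₀ n Rε : ℤ}
    (hu : ¬ (2 : ℤ) ∣ ρ.2.2) (hBN : B + 2 < N) (hsl : ρ.2.1 + 2 * D ≤ B)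
    (relL : (2 : ℤ) ^ N ∣ (2 : ℤ) ^ ρ.2.1 * ρ.2.2 * Rε ^ 2 - (w₀ - n ^ 2 * ρ.1))
    (relQ : (2 : ℤ) ^ N ∣ (2 : ℤ) ^ sq * (qmul s₁ s₀ Zq (qmul s₁ s₀ R R)).1 -
        (wtw cw dw b (w₀ - n ^ 2 * E.1, -(n ^ 2 * E.2))).1 ∧
      (2 : ℤ) ^ N ∣ (2 : ℤ) ^ sq * (qmul s₁ s₀ Zq (qmul s₁ s₀ R R)).2 -
        (wtw cw dw b (w₀ - n ^ 2 * E.1, -(n ^ 2 * E.2))).2)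
    (hidx : (2 : ℤ) ∣ n → (2 : ℤ) ^ (D + 1) ∣ Rε → (2 : ℤ) ^ (D + 1) ∣ R.1 → (2 : ℤ) ^ (D + 1) ∣ R.2 → False)
    (hquad : (2 : ℤ) ^ (B + 1) ∣ w₀ - n ^ 2 * E.1 → (2 : ℤ) ^ (B + 1) ∣ -(n ^ 2 * E.2) →
      (2 : ℤ) ^ (D + 1) ∣ R.1 ∧ (2 : ℤ) ^ (D + 1) ∣ R.2)
    (hwalkS : ∀ K : ℕ, K ≤ B → K % 2 = 0 → ∀ y : ℤ,
      (∃ X : ℤ, (2 : ℤ) ^ N ∣ (2 : ℤ) ^ ρ.2.1 * ρ.2.2 * X ^ 2 - (2 : ℤ) ^ K * (y - ρ.1)) →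
      (∃ R' : ℤ × ℤ,
        (2 : ℤ) ^ N ∣ (2 : ℤ) ^ sq * (qmul s₁ s₀ Zq (qmul s₁ s₀ R' R')).1 -
            (2 : ℤ) ^ K * (wtw cw dw b (y - E.1, -E.2)).1 ∧
          (2 : ℤ) ^ N ∣ (2 : ℤ) ^ sq * (qmul s₁ s₀ Zq (qmul s₁ s₀ R' R')).2 -
            (2 : ℤ) ^ K * (wtw cw dw b (y - E.1, -E.2)).2) → False)
    (hcoreQ : ∀ (μ g : ℕ) (P8 : ℤ) (W R' : ℤ × ℤ), μ % 2 = g % 2 →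
      W.1 ≡ P8 - (2 : ℤ) ^ g * E.1 [ZMOD 8] → W.2 ≡ -((2 : ℤ) ^ g * E.2) [ZMOD 8] → ¬ (2 : ℤ) ∣ W.1 →
      μ + 2 < N →
      (2 : ℤ) ^ N ∣ (2 : ℤ) ^ sq * (qmul s₁ s₀ Zq (qmul s₁ s₀ R' R')).1 - (2 : ℤ) ^ μ * (wtw cw dw b W).1 →
      (2 : ℤ) ^ N ∣ (2 : ℤ) ^ sq * (qmul s₁ s₀ Zq (qmul s₁ s₀ R' R')).2 - (2 : ℤ) ^ μ * (wtw cw dw b W).2 →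
      qpat g P8 = true)
    (hexcl : ∀ g ∈ ([1, 2, 3, 4] : List ℕ), ∀ P8 ∈ ([1, 3, 5, 7] : List ℤ),
      ratPat g P8 ρ = true → qpat g P8 = true → False) : False := by
  have hpZ : Prime (2 : ℤ) := Int.prime_two
  obtain ⟨relQ₁, relQ₂⟩ := relQ
  -- (A) the RATIONAL-like step: `w₀ = 2^μ P`, `n² = 2^μ M`, `8 ∣ M − 2^g`, `g ≥ 1`, `μ ≡ g`, `μ + 2 < N`
  have ratStep : ∀ (μ g : ℕ) (P M : ℤ), 1 ≤ g → ¬ (2 : ℤ) ∣ P → μ % 2 = g % 2 → (8 : ℤ) ∣ M - (2 : ℤ) ^ g →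
      μ + 2 < N → w₀ = (2 : ℤ) ^ μ * P → n ^ 2 = (2 : ℤ) ^ μ * M → False := by
    intro μ g P M hg hP hμg hM hμN hw hn2
    have hM2 : (2 : ℤ) ∣ M := by
      have h8 : (2 : ℤ) ∣ M - (2 : ℤ) ^ g := (show (2 : ℤ) ∣ 8 by norm_num).trans hM
      simpa using dvd_add h8 (dvd_pow_self (2 : ℤ) (by omega : g ≠ 0))
    have hMg : M ≡ (2 : ℤ) ^ g [ZMOD 8] := (Int.modEq_iff_dvd.mpr hM).symm
    -- linear side: `core8` at level `μ` with the odd `P − M·e`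
    have hoddL : ¬ (2 : ℤ) ∣ P - M * ρ.1 := fun h => hP (by simpa using dvd_add h (dvd_mul_of_dvd_left hM2 ρ.1))
    have relL' : (2 : ℤ) ^ N ∣ (2 : ℤ) ^ ρ.2.1 * ρ.2.2 * Rε ^ 2 - (2 : ℤ) ^ μ * (P - M * ρ.1) := by
      have e : (2 : ℤ) ^ μ * (P - M * ρ.1) = w₀ - n ^ 2 * ρ.1 := by rw [hw, hn2]; ring
      rw [e]; exact relL
    obtain ⟨hparL, huL⟩ := core8 hu hoddL μ ρ.2.1 N Rε hμN relL'
    -- quadratic side: the vector `W = (P − M·Ê₀, −M·Ê₁)`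
    have hW1 : ¬ (2 : ℤ) ∣ P - M * E.1 := fun h => hP (by simpa using dvd_add h (dvd_mul_of_dvd_left hM2 E.1))
    have hX : (w₀ - n ^ 2 * E.1, -(n ^ 2 * E.2)) =
        ((2 : ℤ) ^ μ * (P - M * E.1, -(M * E.2)).1, (2 : ℤ) ^ μ * (P - M * E.1, -(M * E.2)).2) := by
      rw [hw, hn2]; simp only [Prod.mk.injEq]; constructor <;> ring
    rw [hX, wtw_smul] at relQ₁ relQ₂
    obtain ⟨g', hg', P8, hP8, hgg, h2g, hPP⟩ := reduce_gP hg hP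
    have hMg' : M ≡ (2 : ℤ) ^ g' [ZMOD 8] := hMg.trans h2g.symm
    refine hexcl g' hg' P8 hP8 ?_ (hcoreQ μ g' P8 (P - M * E.1, -(M * E.2)) R (by omega)
      (hPP.symm.sub (hMg'.mul_right _)) (hMg'.mul_right _).neg hW1 hμN relQ₁ relQ₂)
    have castg : ((2 ^ g' : ℕ) : ℤ) = (2 : ℤ) ^ g' := by simp
    simp only [ratPat, Bool.and_eq_true, decide_eq_true_eq, castg]
    exact ⟨by omega, huL.trans (hPP.symm.sub (hMg'.mul_right _))⟩
  -- (B) the WALK case: `n = 2^τ n'`, `n'` odd, `w₀ = 2^{2τ} w₁`, `2τ ≤ B`: `y = w₁·m²`, `m ≡ n'⁻¹ (mod 2^N)`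
  have walkCase : ∀ (τ : ℕ) (n' w₁ : ℤ), ¬ (2 : ℤ) ∣ n' → n = (2 : ℤ) ^ τ * n' → w₀ = (2 : ℤ) ^ (2 * τ) * w₁ →
      2 * τ ≤ B → False := by
    intro τ n' w₁ hnd hn' hw₁ h2τ
    have hn2 : n ^ 2 = (2 : ℤ) ^ (2 * τ) * n' ^ 2 := by rw [hn']; ring
    obtain ⟨m, k, hmk⟩ : IsCoprime n' ((2 : ℤ) ^ N) := ((Prime.coprime_iff_not_dvd hpZ).mpr hnd).symm.pow_right
    have hX : (w₀ - n ^ 2 * E.1, -(n ^ 2 * E.2)) = ((2 : ℤ) ^ (2 * τ) * (w₁ - n' ^ 2 * E.1, -(n' ^ 2 * E.2)).1,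
        (2 : ℤ) ^ (2 * τ) * (w₁ - n' ^ 2 * E.1, -(n' ^ 2 * E.2)).2) := by
      simp only [Prod.mk.injEq]
      exact ⟨by linear_combination hw₁ - E.1 * hn2, by linear_combination -(E.2 * hn2)⟩
    rw [hX, wtw_smul] at relQ₁ relQ₂
    refine hwalkS (2 * τ) h2τ (by omega) (w₁ * m ^ 2) ⟨Rε * m, ?_⟩ ⟨(m * R.1, m * R.2), quad_scale hmk relQ₁ relQ₂⟩
    obtain ⟨t, ht⟩ := relL
    rw [hw₁, hn2] at ht
    exact ⟨m ^ 2 * t + (2 : ℤ) ^ (2 * τ) * ρ.1 * k * (1 + m * n'), by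
      linear_combination m ^ 2 * ht - (2 : ℤ) ^ (2 * τ) * ρ.1 * (1 + m * n') * hmk⟩
  -- (C) the case analysis on `n`
  by_cases hn : (2 : ℤ) ∣ n
  · -- the ANCHOR: `2^(B+1) ∣ w₀` and `2^(B+1) ∣ n²` is impossible
    have hanchor : ¬ ((2 : ℤ) ^ (B + 1) ∣ w₀ ∧ (2 : ℤ) ^ (B + 1) ∣ n ^ 2) := by
      rintro ⟨hw, hnn⟩
      obtain ⟨hR1, hR2⟩ := hquad (dvd_sub hw (dvd_mul_of_dvd_left hnn _)) (dvd_mul_of_dvd_left hnn _).neg_right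
      refine hidx hn ?_ hR1 hR2
      by_contra hRε
      have hsq : ¬ (2 : ℤ) ^ (2 * D + 1) ∣ Rε ^ 2 := by
        have := not_dvd_sq_of Nat.prime_two hRε
        simpa using this
      apply hsq
      have h1 : (2 : ℤ) ^ (B + 1) ∣ (2 : ℤ) ^ ρ.2.1 * ρ.2.2 * Rε ^ 2 := by
        have := dvd_add ((pow_dvd_pow (2 : ℤ) (by omega : B + 1 ≤ N)).trans relL)
          (dvd_sub hw (dvd_mul_of_dvd_left hnn ρ.1))
        simpa using this
      have h2 : (2 : ℤ) ^ ((2 * D + 1) + ρ.2.1) ∣ (2 : ℤ) ^ ρ.2.1 * (ρ.2.2 * Rε ^ 2) := by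
        rw [← mul_assoc]; exact (pow_dvd_pow _ (by omega)).trans h1
      exact (((Prime.coprime_iff_not_dvd hpZ).mpr hu).pow_left).dvd_of_dvd_mul_left (pow_dvd_cancel h2)
    rcases eq_or_ne n 0 with hn0 | hn0
    · -- `n = 0`: diagonal RATIONAL-like pattern, `g = μ + 4`, `M = 0`
      subst hn0
      have hw : ¬ (2 : ℤ) ^ (B + 1) ∣ w₀ := fun h => hanchor ⟨h, by simp⟩
      obtain ⟨μ, P, hP, hPodd, hμ⟩ := split_of_not_dvd hw
      refine ratStep μ (μ + 4) P 0 (by omega) hPodd (by omega) ?_ (by omega) hP (by simp)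
      rw [zero_sub, dvd_neg, pow_add]
      exact dvd_mul_of_dvd_right (by norm_num) _
    · obtain ⟨τ, n', hn', hnd⟩ : ∃ (k : ℕ) (x' : ℤ), n = (2 : ℤ) ^ k * x' ∧ ¬ (2 : ℤ) ∣ x' :=
        ⟨_, (Int.finiteMultiplicity_iff.mpr ⟨by decide, hn0⟩).exists_eq_pow_mul_and_not_dvd⟩
      have hn2 : n ^ 2 = (2 : ℤ) ^ (2 * τ) * n' ^ 2 := by rw [hn']; ring
      by_cases hwd : (2 : ℤ) ^ (2 * τ) ∣ w₀
      · -- the walk with the even offset `K = 2τ ≤ B` (anchor)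
        have h2τ : 2 * τ ≤ B := by
          by_contra hlt
          exact hanchor ⟨(pow_dvd_pow _ (by omega)).trans hwd,
            hn2 ▸ dvd_mul_of_dvd_left (pow_dvd_pow _ (by omega)) _⟩
        obtain ⟨w₁, hw₁⟩ := hwd
        exact walkCase τ n' w₁ hnd hn' hw₁ h2τ
      · -- `w₀ = 2^μ P`, `μ < 2τ`: RATIONAL-like with `g = 2τ − μ ≥ 1`, `M = 2^g n'²`
        have hw0 : w₀ ≠ 0 := fun h => hwd (h ▸ dvd_zero _)
        obtain ⟨μ, P, hP, hPodd⟩ : ∃ (k : ℕ) (x' : ℤ), w₀ = (2 : ℤ) ^ k * x' ∧ ¬ (2 : ℤ) ∣ x' :=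
          ⟨_, (Int.finiteMultiplicity_iff.mpr ⟨by decide, hw0⟩).exists_eq_pow_mul_and_not_dvd⟩
        have hμτ : μ < 2 * τ := by
          by_contra hle
          exact hwd (hP ▸ dvd_mul_of_dvd_left (pow_dvd_pow _ (by omega)) P)
        have hμB : μ ≤ B := by
          by_contra hlt
          exact hanchor ⟨hP ▸ dvd_mul_of_dvd_left (pow_dvd_pow _ (by omega)) P,
            hn2 ▸ dvd_mul_of_dvd_left (pow_dvd_pow _ (by omega)) _⟩
        obtain ⟨g, hg⟩ : ∃ g, 2 * τ = μ + g := ⟨2 * τ - μ, by omega⟩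
        have h81 : (8 : ℤ) ∣ n' ^ 2 - 1 := by
          have := sq_emod_eight_of_not_two_dvd hnd
          omega
        refine ratStep μ g P ((2 : ℤ) ^ g * n' ^ 2) (by omega) hPodd (by omega) ?_ (by omega) hP ?_
        · rw [show (2 : ℤ) ^ g * n' ^ 2 - (2 : ℤ) ^ g = (2 : ℤ) ^ g * (n' ^ 2 - 1) by ring]
          exact dvd_mul_of_dvd_right h81 _
        · rw [hn2, hg, pow_add]; ring
  · -- `n` odd: the walk with `K = 0`
    exact walkCase 0 n w₀ hn (by simp) (by simp) (by omega)

end Summit.BirchSwinnertonDyer.BirchSwinnertonDyer.Rank2Observatory.TwoDescKill
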